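import Summits.ResolutionOfSingularities.ResolutionOfSingularities.Theorems.FrobeniusLadderFInjectiveMacaulayficationHypersurfacePointBlowup
import Summits.ResolutionOfSingularities.ResolutionOfSingularities.Theorems.FrobeniusLadderFInjectiveMacaulayficationHypersurfaceRegular
import Summits.ResolutionOfSingularities.ResolutionOfSingularities.Theorems.FrobeniusLadderFInjectiveMacaulayficationClauseOfPderivNotMem
import Summits.ResolutionOfSingularities.ResolutionOfSingularities.Theorems.FrobeniusLadderFInjectiveMacaulayficationWildPinchFan
import Literature.AlgebraicGeometry.Motives.HypersurfaceFormsIrreducible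
import Mathlib.Algebra.MvPolynomial.Equiv
import Mathlib.Algebra.MvPolynomial.PDeriv
import HarnessLib

/-!
# The crux statement for the FERMAT CUBIC CONES `x₀³ + ⋯ + x_{n-1}³ = 0 ⊂ 𝔸ⁿ` in characteristic `2`, EVERY `n ≥ 3` (T-F cone instances)
# (crux `FInjectiveMacaulayfication` stmt-ResolutionOfSingularities-15315, chain w45a, door v30; line T-F under #4β, RULING R13.49 / R14.4 (2))

[OURS · L1 W4.5a · res-L1-w45a-lead-1 gen 5] Support file (`--supports stmt-ResolutionOfSingularities-15315 --as helper`); NOT a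
statement of any manuscript; AI-written, weaker than expert review.

`X = Spec k[x₀,…,x_{n-1}]/(f)`, `f = Σ xₗ³`, `char k = 2`, `n ≥ 3`: the affine cone over the smooth Fermat cubic `V₊(f) ⊂ ℙⁿ⁻¹`
(`∂f/∂xₗ = xₗ²` in characteristic `2`); the vertex is bad (`f ∈ 𝔪^{[2]}`). res-L1-w45a-plan-1 asked for `d = 3, 4` (`n = 4, 5`); the
certificate is uniform in `n`. ONE point blow-up: the strict transforms are the dehomogenised cubics `gᵢ = 1 + Σ_{l ≠ i} xₗ³` (smooth),
and `HypersurfacePointBlowup.hypersurfacePointBlowupFiModel` turns the certificates into the CRUX STATEMENT: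
* `theta` — `θᵢ f = xᵢ³ · gᵢ`;  `pderiv_f`, `pderiv_g` — `∂f/∂xⱼ = 3xⱼ²`, `∂gᵢ/∂xⱼ = 3xⱼ²` (`j ≠ i`);
* `prime_fermat` — `f ≅ T³ + C(Σ_{l<n-1} yₗ³)` is irreducible: Eisenstein at the rational point `(1,1,0,…,0)` where `Σ yₗ³ = 2 = 0` and
  `∂/∂y₀ = 3 = 1` (`Literature…SmoothHypersurface.irreducible_X_pow_add_C`);
* `fInjectiveMacaulayfication_fermatCubicCone_char2 (n) (hn : 3 ≤ n)` — `∃ X' → X` proper birational, every stalk a domain with weakly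
  regular systems of parameters generating Frobenius-closed ideals.
[folklore mathematics; OURS as a certificate]
-/

-- single-problem summit: the doubled namespace component is forced
set_option linter.dupNamespace false

noncomputable section

namespace Summit.ResolutionOfSingularities.ResolutionOfSingularities.Theorems.FInjectiveMacaulayfication.FermatCubicConeChar2

open MvPolynomial
open Summit.ResolutionOfSingularities.ResolutionOfSingularities.Theorems.FInjectiveMacaulayfication
open Summit.ResolutionOfSingularities.ResolutionOfSingularities.Theorems.FInjectiveMacaulayfication.WildPinchClosedCentre

/-! ## §1 Polynomial identities (any commutative exponent bookkeeping, any `n`) -/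

/-- **`θᵢ f = xᵢ³ · (1 + Σ_{l ≠ i} xₗ³)`** for the charts of the blowing up of the origin of `𝔸ⁿ`. [folklore] -/
theorem theta (k : Type) [Field k] {n : ℕ} (f : MvPolynomial (Fin n) k) (hf : f = ∑ l : Fin n, X l ^ 3) (i : Fin n) :
    aeval (fun j : Fin n => if j = i then (X i : MvPolynomial (Fin n) k) else X j * X i) f =
      X i ^ 3 * (1 + ∑ l ∈ Finset.univ.erase i, (X l : MvPolynomial (Fin n) k) ^ 3) := by
  rw [hf, map_sum, ← Finset.add_sum_erase _ _ (Finset.mem_univ i)]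
  simp only [map_pow, aeval_X, if_true]
  have h : ∑ l ∈ Finset.univ.erase i, ((if l = i then (X i : MvPolynomial (Fin n) k) else X l * X i) ^ 3) =
      ∑ l ∈ Finset.univ.erase i, (X l : MvPolynomial (Fin n) k) ^ 3 * X i ^ 3 :=
    Finset.sum_congr rfl fun l hl => by rw [if_neg (Finset.ne_of_mem_erase hl)]; ring
  rw [h, ← Finset.sum_mul]
  ring

/-- `∂f/∂xⱼ = 3xⱼ²`. [folklore] -/
theorem pderiv_f (k : Type) [Field k] {n : ℕ} (f : MvPolynomial (Fin n) k) (hf : f = ∑ l : Fin n, X l ^ 3) (j : Fin n) :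
    pderiv j f = 3 * X j ^ 2 := by
  rw [hf, map_sum, Finset.sum_eq_single j (fun l _ hl => by rw [pderiv_pow, pderiv_X_of_ne hl, mul_zero])
    (fun h => absurd (Finset.mem_univ j) h), pderiv_pow, pderiv_X_self, mul_one]
  push_cast
  ring

/-- `∂gᵢ/∂xⱼ = 3xⱼ²` for `j ≠ i`, `gᵢ = 1 + Σ_{l ≠ i} xₗ³`. [folklore] -/
theorem pderiv_g (k : Type) [Field k] {n : ℕ} (i j : Fin n) (hji : j ≠ i) :
    pderiv j (1 + ∑ l ∈ Finset.univ.erase i, (X l : MvPolynomial (Fin n) k) ^ 3) = 3 * X j ^ 2 := by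
  rw [map_add, pderiv_one, zero_add, map_sum,
    Finset.sum_eq_single_of_mem j (Finset.mem_erase.mpr ⟨hji, Finset.mem_univ j⟩)
      (fun l _ hl => by rw [pderiv_pow, pderiv_X_of_ne hl, mul_zero]), pderiv_pow, pderiv_X_self, mul_one]
  push_cast
  ring

/-- `(2 : k[X]) = 0` and `(3 : k[X]) = 1` in characteristic `2`. -/
theorem two_three (k : Type) [Field k] [CharP k 2] {n : ℕ} :
    (2 : MvPolynomial (Fin n) k) = 0 ∧ (3 : MvPolynomial (Fin n) k) = 1 := by
  have h2 : (2 : MvPolynomial (Fin n) k) = 0 := two_eq_zero k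
  refine ⟨h2, ?_⟩
  rw [show (3 : MvPolynomial (Fin n) k) = 2 + 1 by norm_num, h2, zero_add]

/-- `f(eⱼ) = 1`: the Fermat cubic does not vanish at a coordinate point. [folklore] -/
theorem eval_single (k : Type) [Field k] {n : ℕ} (f : MvPolynomial (Fin n) k) (hf : f = ∑ l : Fin n, X l ^ 3) (j : Fin n) :
    MvPolynomial.eval (Pi.single j (1 : k)) f = 1 := by
  rw [hf, map_sum, Finset.sum_eq_single j (fun l _ hl => by rw [map_pow, eval_X, Pi.single_eq_of_ne hl, zero_pow three_ne_zero])
    (fun h => absurd (Finset.mem_univ j) h), map_pow, eval_X, Pi.single_eq_same, one_pow]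

/-! ## §2 Primality (characteristic `2`, `n = m + 3 ≥ 3`) -/

/-- **`f = Σ_{l < m+3} xₗ³` is prime in characteristic `2`**: `k[X₀,…] ≃ k[Y][T]` (`X₀ ↦ T`), `f ↦ T³ + C c`, `c = Σ_{l < m+2} Yₗ³`,
Eisenstein at `a = (1,1,0,…,0)`: `c(a) = 2 = 0`, `(∂c/∂Y₀)(a) = 3 = 1 ≠ 0`. [folklore] -/
theorem prime_fermat (k : Type) [Field k] [CharP k 2] (m : ℕ) (f : MvPolynomial (Fin (m + 3)) k)
    (hf : f = ∑ l : Fin (m + 3), X l ^ 3) : Prime f := by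
  set e : MvPolynomial (Fin (m + 3)) k ≃+* Polynomial (MvPolynomial (Fin (m + 2)) k) := (finSuccEquiv k (m + 2)).toRingEquiv
    with he_def
  have he0 : e (X 0) = Polynomial.X := finSuccEquiv_X_zero
  have hes : ∀ l : Fin (m + 2), e (X l.succ) = Polynomial.C (X l) := fun l => finSuccEquiv_X_succ (j := l)
  set c : MvPolynomial (Fin (m + 2)) k := ∑ l : Fin (m + 2), X l ^ 3 with hc
  have hef : e f = Polynomial.X ^ 3 + Polynomial.C c := by
    rw [hf, Fin.sum_univ_succ, map_add, map_pow, he0, map_sum, hc, map_sum]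
    congr 1
    exact Finset.sum_congr rfl fun l _ => by rw [map_pow, hes, map_pow]
  -- the rational point `a = (1, 1, 0, …, 0)`
  set a : Fin (m + 2) → k := Fin.cons 1 (Fin.cons 1 fun _ => 0) with ha
  have h2 : (2 : k) = 0 := by simpa using CharP.cast_eq_zero k 2
  have hcval : MvPolynomial.eval a c = 0 := by
    rw [hc, map_sum]
    simp only [map_pow, eval_X]
    rw [Fin.sum_univ_succ, Fin.sum_univ_succ]
    simp only [ha, Fin.cons_zero, Fin.cons_succ, one_pow, zero_pow three_ne_zero, Finset.sum_const_zero, add_zero]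
    rw [show (1 : k) + 1 = 2 by norm_num, h2]
  have hpd : pderiv 0 c = 3 * X 0 ^ 2 := pderiv_f k c hc 0
  have hder : MvPolynomial.eval a (pderiv 0 c) ≠ 0 := by
    rw [hpd]
    simp only [map_mul, map_pow, eval_X, ha, Fin.cons_zero, one_pow, mul_one]
    rw [show (MvPolynomial.eval (Fin.cons 1 (Fin.cons 1 fun _ => (0 : k)) : Fin (m + 2) → k)) 3 = (2 : k) + 1 by
      rw [map_ofNat]; norm_num, h2, zero_add]
    exact one_ne_zero
  have hirr : Irreducible (e f) := by
    rw [hef]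
    exact Literature.AlgebraicGeometry.Motives.SmoothHypersurface.irreducible_X_pow_add_C (d := 3) (by norm_num) c a hcval 0 hder
  exact (MulEquiv.prime_iff e).mp hirr.prime

/-! ## §3 The model -/

/-- The element `g` lies in every ideal pulled back from `k[X]/(g)`. -/
theorem self_mem_comap {k : Type} [Field k] {n : ℕ} (g : MvPolynomial (Fin n) k) (P : Ideal (MvPolynomial (Fin n) k ⧸ Ideal.span {g})) :
    g ∈ P.comap (Ideal.Quotient.mk (Ideal.span {g})) := by
  rw [Ideal.mem_comap, Ideal.Quotient.eq_zero_iff_mem.mpr (Ideal.mem_span_singleton_self g)]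
  exact zero_mem _

set_option maxHeartbeats 800000 in
/-- **THE CRUX STATEMENT FOR THE FERMAT CUBIC CONES IN CHARACTERISTIC 2, EVERY `n ≥ 3`.** For every field `k` of characteristic `2`,
every `n ≥ 3` and `X = Spec k[x₀,…,x_{n-1}]/(Σ xₗ³)` (the cone over the smooth Fermat cubic of dimension `n - 2`; bad vertex) there is a
proper birational `X' → X` (the blow-up of the vertex) all of whose stalks are domains in which every system of parameters is weakly
regular and generates a Frobenius-closed ideal. T-F cone instances `d = n - 1 = 2, 3, 4, …` at once (res-L1-w45a-plan-1 R13.49 (2),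
R14.4 (2)), through `HypersurfacePointBlowup.hypersurfacePointBlowupFiModel`. [folklore mathematics; OURS as a certificate] -/
theorem fInjectiveMacaulayfication_fermatCubicCone_char2 (n : ℕ) (hn : 3 ≤ n) (k : Type) [Field k] [CharP k 2]
    (f : MvPolynomial (Fin n) k) (hf : f = ∑ l : Fin n, X l ^ 3) :
    ∃ (X' : AlgebraicGeometry.Scheme.{0}) (π : X' ⟶ AlgebraicGeometry.Spec (.of (MvPolynomial (Fin n) k ⧸ Ideal.span {f}))),
      AlgebraicGeometry.IsProper π ∧ Literature.AlgebraicGeometry.Resolution.IsBirational π ∧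
      ∀ y : X', IsDomain (X'.presheaf.stalk y) ∧ ∀ d : ℕ, ringKrullDim (X'.presheaf.stalk y) = d →
        ∀ s : Fin d → X'.presheaf.stalk y, (Ideal.span (Set.range s)).radical.IsMaximal →
          RingTheory.Sequence.IsWeaklyRegular (X'.presheaf.stalk y) (List.ofFn s) ∧
          ∀ z : X'.presheaf.stalk y, (∃ e : ℕ, z ^ 2 ^ e ∈
              Ideal.span ((fun w : X'.presheaf.stalk y => w ^ 2 ^ e) ''
                (Ideal.span (Set.range s) : Set (X'.presheaf.stalk y)))) →
            z ∈ Ideal.span (Set.range s) := by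
  obtain ⟨m, rfl⟩ : ∃ m, n = m + 3 := ⟨n - 3, by omega⟩
  haveI : Fact (Nat.Prime 2) := ⟨Nat.prime_two⟩
  have hprime := prime_fermat k m f hf
  have h23 := two_three k (n := m + 3)
  -- in characteristic 2 the partials are squares of variables
  have hdf : ∀ j : Fin (m + 3), pderiv j f = X j ^ 2 := fun j => by rw [pderiv_f k f hf j, h23.2, one_mul]
  have hdg : ∀ i j : Fin (m + 3), j ≠ i →
      pderiv j (1 + ∑ l ∈ Finset.univ.erase i, (X l : MvPolynomial (Fin (m + 3)) k) ^ 3) = X j ^ 2 := fun i j hji => by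
    rw [pderiv_g k i j hji, h23.2, one_mul]
  refine HypersurfacePointBlowup.hypersurfacePointBlowupFiModel 2 k (m + 3) f
    (fun i => 1 + ∑ l ∈ Finset.univ.erase i, (X l : MvPolynomial (Fin (m + 3)) k) ^ 3) 3
    ((Ideal.span_singleton_prime hprime.ne_zero).mpr hprime) (theta k f hf) ?_ ?_ ?_ ?_
  · -- `f ∉ (xᵢ)`: `f(eⱼ) = 1` for `j ≠ i`
    intro i
    rw [Ideal.mem_span_singleton]
    have hj : ∃ j : Fin (m + 3), j ≠ i := by
      by_cases hi : i = 0
      · exact ⟨1, by rw [hi]; exact (ne_of_lt Fin.zero_lt_one).symm⟩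
      · exact ⟨0, fun h => hi h.symm⟩
    obtain ⟨j, hji⟩ := hj
    exact not_X_dvd_of_eval (Pi.single j 1) i (Pi.single_eq_of_ne (Ne.symm hji) _) f (by rw [eval_single k f hf j]; exact one_ne_zero)
  · -- `gᵢ ∉ (xᵢ)`: `gᵢ(0) = 1`
    intro i
    rw [Ideal.mem_span_singleton]
    refine not_X_dvd_of_eval (fun _ => 0) i rfl _ ?_
    simp [zero_pow three_ne_zero]
  · -- off the vertex `X` is regular: some `xⱼ ∉ P`, `∂f/∂xⱼ = xⱼ²`
    intro P hP hnot
    have hP' : (P.comap (Ideal.Quotient.mk (Ideal.span {f}))).IsPrime := Ideal.comap_isPrime _ _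
    obtain ⟨_, ⟨j, rfl⟩, hj⟩ := Set.not_subset.mp (fun h => hnot (Ideal.span_le.mpr h))
    have hj' : (X j : MvPolynomial (Fin (m + 3)) k) ∉ P.comap (Ideal.Quotient.mk (Ideal.span {f})) := hj
    exact HypersurfaceRegular.stub_hypersurfaceRegularOfPderiv k (m + 3) f j P
      (by rw [hdf j]; exact fun h => hj' (hP'.mem_of_pow_mem 2 h))
  · -- the chart hypersurfaces `gᵢ = 1 + Σ_{l≠i} xₗ³` are regular: some `xⱼ ∉ Q` (`j ≠ i`), `∂gᵢ/∂xⱼ = xⱼ²`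
    intro i Q hQ _
    have hP : (Q.comap (Ideal.Quotient.mk (Ideal.span
        {(1 + ∑ l ∈ Finset.univ.erase i, (X l : MvPolynomial (Fin (m + 3)) k) ^ 3)}))).IsPrime := Ideal.comap_isPrime _ _
    have hex : ∃ j : Fin (m + 3), j ≠ i ∧ (X j : MvPolynomial (Fin (m + 3)) k) ∉
        Q.comap (Ideal.Quotient.mk (Ideal.span {(1 + ∑ l ∈ Finset.univ.erase i, (X l : MvPolynomial (Fin (m + 3)) k) ^ 3)})) := by
      refine Classical.by_contradiction fun hall => ?_
      simp only [not_exists, not_and, not_not] at hall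
      have hsum : (∑ l ∈ Finset.univ.erase i, (X l : MvPolynomial (Fin (m + 3)) k) ^ 3) ∈
          Q.comap (Ideal.Quotient.mk (Ideal.span {(1 + ∑ l ∈ Finset.univ.erase i, (X l : MvPolynomial (Fin (m + 3)) k) ^ 3)})) :=
        Ideal.sum_mem _ fun l hl => by
          rw [pow_succ]
          exact Ideal.mul_mem_left _ _ (hall l (Finset.ne_of_mem_erase hl))
      have hg := self_mem_comap (1 + ∑ l ∈ Finset.univ.erase i, (X l : MvPolynomial (Fin (m + 3)) k) ^ 3) Q
      have hmem := sub_mem hg hsum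
      rw [add_sub_cancel_right] at hmem
      exact hP.ne_top ((Ideal.eq_top_iff_one _).mpr hmem)
    obtain ⟨j, hji, hj⟩ := hex
    exact ClauseOfPderivNotMem.stub_clauseOfPderivNotMem 2 k (m + 3) _ Q j
      (by rw [hdg i j hji]; exact fun h => hj (hP.mem_of_pow_mem 2 h))

end Summit.ResolutionOfSingularities.ResolutionOfSingularities.Theorems.FInjectiveMacaulayfication.FermatCubicConeChar2
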